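/-
Copyright (c) 2026 the pub-hodgecm-mathlib formalisation cell (harness21).  Prover seat hodgecm-mathlib-F0P2-p06 (g12): road «S3-ram» (LEAD F0P3a-plan (g12); architect
A-p16 (g31); owner F0P3a-p06 (g15)), organ A′ (ii) (B4) G3′ «THE ν-BRIDGE»: passing neighbours of a fixed vertex ↔ `Q_Ȳ`-null isotropic points of the residual conic;
2026-09-02.
-/
import Literature.NumberTheory.Automorphic.UnitaryLatticeTreeFixedGrandchildrenCountRamified   -- ★ p847297 (this seat): G3⁺ (passing ⟺ residual test, transport to `u·L₀`)
import Literature.NumberTheory.Automorphic.UnitaryLatticeTreeRootStarCountOfInvolution       -- ★ R2b (B-p14): normal forms of isotropic points, `star(L₀) ≃ Option(conic)`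
import Literature.GroupTheory.SpecificGroups.OrthogonalThreeIsotropicPointsNilpotentForm       -- ★ p847096 (F0P3-p03): the residual currency `z ⬝ᵥ (J₀ *ᵥ z)`, `z ⬝ᵥ ((J₀ * Y) *ᵥ z)`
import HarnessLib

/-!
# The lattice graph of a hermitian space — THE ν-BRIDGE at a tamely ramified place: the modular neighbours of a fixed self-dual vertex through which a deep `γ`
# fixes everything ↔ the isotropic points `x̄` of the residual conic with `ᵗx̄ (J₀Ȳ) x̄ = 0` (Bruhat–Tits 1972 §10; Tits 1979 §3.5; Serre, *Trees* II.1.1)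

Topic `NumberTheory/Automorphic`; namespace `Literature.NumberTheory.Automorphic.UnitaryLatticeTree`.  THEOREMS ONLY (no definition, no instance, no notation, no named fact,
no `sorry`); kernel lane `--supports stmt-HodgeConjecture-24833`.  Cell `pub/hodgecm-mathlib` (D-0151), crux H413; road «S3-ram» (Literature seeding), organ A′ (ii) of the
P-1-ram skeleton (architect A-p16 (g31)), gap G3 = (B4) of the blueprint «(a2)(B) TREE INDUCTION» (F0P3a-p01 (g16)), part G3′: ★ G3⁺ (p847297) counts the fixed
grandchildren of a fixed self-dual vertex `v` as `q · #{children passing}` with `#{children passing} + 1 = ν := #{neighbours of v all of whose neighbours are fixed}`;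
THIS FILE identifies `ν` with a RESIDUAL count, the input of ★ `OrthogonalThreeIsotropicPointsNilpotentForm` (F0P3-p03 (g14)): reading `v = u·L₀` at the root with
`γ′ = u⁻¹γu ≡ 1 (mod ϖ)` and `Ȳ = (γ′ − 1)∕ϖ mod ϖ`,
  **`ν = #{p ∈ Option(conic) : ᵗx̄_p (J₀Ȳ) x̄_p = 0}`**,  `x̄_∞ = e₂`, `x̄_(ā,b̄) = (1, ā, b̄)` (`2b̄ + ā² = 0`) the normalised isotropic points of ★ R2b,
so that `(q − 1)·ν = #{x̄ ∈ 𝓀³ ∖ 0 : ᵗx̄J₀x̄ = 0 ∧ ᵗx̄(J₀Ȳ)x̄ = 0}` is `(q−1)·{q+1, 2, 1}` by the `O(J₀)`-type of the nilpotent `J₀`-symmetric `Ȳ` (★ p847096 (C3)(C4); the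
rank token of the (a2) label sheet).  DATUM-FREE ramified tokens as in ★ G3∕G3⁺ (`σ` valuation-preserving involution, `σϖ = −ϖ`, residually trivial, `|2| = 1`, finite `𝓀`);
`Ȳ` enters through an `𝒪`-valued matrix `Y₀` with `Y₀ = ϖ⁻¹(γ′ − 1)` entrywise (binder + hypothesis, no definition), residual vectors are `Fin 3 → 𝓀[K]`.

* §1 RESIDUAL READING (`x ∈ 𝒪³` given as `x₀ : Fin 3 → 𝒪`): `residue_map_sigma_eq` (`σ̄ = id`), `v_B₀_self_lt_one_iff_residue` (`|B₀ x x| < 1 ↔ ᵗx̄J₀x̄ = 0`),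
  **`v_test_lt_one_iff_residue`** (`|ϖ⁻¹B₀(x,(γ′−1)x)| < 1 ↔ ᵗx̄(J₀Ȳ)x̄ = 0`), `exists_v_eq_one_iff_residue_ne_zero` (primitive ↔ `x̄ ≠ 0`).
* §2 THE TEST IS A FUNCTION OF THE NEIGHBOUR: `v_test_lt_one_iff_of_exists_unit_congr` (congruent representatives), **`forall_fixed_neighbor_iff_v_test_lt_one_of_forall_mem_iff`**
  (for ANY primitive isotropic `x` cutting out the neighbour `w = N_x`: `w` passes ⟺ the test holds at `x`).
* §3 **`ncard_passingNeighbors_root_eq_natCard`** (`ν` at the root `=` the number of null normalised parameters), **`ncard_passingNeighbors_eq_natCard`** (at `u·L₀`).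

HONEST LABEL: HC_CM is proved only modulo the 2 remaining named inputs (hLiu418 24832, h413 24833) until rung 0 closes; nothing printed is asserted here (residual
bookkeeping over ★ results); «S3-ram» has no books consequence.

## References
* [BruhatTits1972] F. Bruhat, J. Tits, *Groupes réductifs sur un corps local I*, Publ. Math. IHÉS 41 (1972), §10 (the star of a vertex = the residual building; here the
  conic of isotropic points of `(𝓀³, J̄₀)`).
* [Tits1979] J. Tits, *Reductive groups over local fields*, PSPM 33.1 (1979), §2.4, §3.5 (ramified `U(3)`; reduction mod `𝔭`).
* [Serre1980Trees] J.-P. Serre, *Trees* (1980), Ch. II §1.1 (neighbours of a lattice = points of the residual projective line∕conic).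
* [Kottwitz1986] R. E. Kottwitz, *Base change for unit elements of Hecke algebras*, Compositio Math. 60 (1986), §3.
-/

set_option autoImplicit false

noncomputable section

open scoped Valued WithZero Matrix MatrixGroups

namespace Literature.NumberTheory.Automorphic.UnitaryLatticeTree

open Literature.NumberTheory.Automorphic Literature.NumberTheory.Automorphic.HermitianLattice
open Literature.NumberTheory.Automorphic.CartanUnique Literature.NumberTheory.Automorphic.UnitaryGroup
open Literature.GroupTheory.SpecificGroups

variable {K : Type*} [Field K] [Valued K ℤᵐ⁰] {σ : K →+* K} {ϖ : K}

/-! ## §1 Residual reading of isotropy, of the test, of primitivity -/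

/-- `σ` preserves `𝒪` when it preserves the valuation. [cite: Tits1979, §3.5] -/
theorem map_coe_mem_integer (hvσ : ∀ a, Valued.v (σ a) = Valued.v a) (x : 𝒪[K]) : σ (x : K) ∈ 𝒪[K] :=
  (Valuation.mem_integer_iff _ _).2 (by rw [hvσ]; exact x.2)

/-- **Residually trivial `σ`**: `σ̄ = id` on `𝓀`, i.e. `residue (σ x) = residue x` for `x ∈ 𝒪` (the tame-ramified token `|σx − x| < 1`). [cite: Tits1979, §3.5] -/
theorem residue_map_sigma_eq (hvσ : ∀ a, Valued.v (σ a) = Valued.v a) (hres : ∀ x : K, Valued.v x ≤ 1 → Valued.v (σ x - x) < 1) (x : 𝒪[K]) :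
    IsLocalRing.residue 𝒪[K] ⟨σ (x : K), map_coe_mem_integer hvσ x⟩ = IsLocalRing.residue 𝒪[K] x := by
  rw [← sub_eq_zero, ← map_sub, residue_eq_zero_iff_v_lt_one]
  exact hres x x.2

/-- `ᵗz J̄₀ v = Σ_i z_i v_{rev i}` on `𝓀³`. [cite: BruhatTits1972, §10] -/
theorem dotProduct_antidiagonal_three_mulVec_eq_sum {F : Type*} [Field F] (z v : Fin 3 → F) :
    z ⬝ᵥ (((StdForm.antidiagonal 3).over F) *ᵥ v) = ∑ i, z i * v (Fin.rev i) := by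
  rw [antidiagonal_three_over_eq]
  simp [Matrix.mulVec, dotProduct, Fin.sum_univ_three]

/-- **RESIDUAL ISOTROPY**: for `x ∈ 𝒪³`, `|B₀ x x| < 1 ↔ ᵗx̄ J̄₀ x̄ = 0` (`σ̄ = id`). [cite: BruhatTits1972, §10] [cite: Tits1979, §3.5] -/
theorem v_B₀_self_lt_one_iff_residue (hvσ : ∀ a, Valued.v (σ a) = Valued.v a) (hres : ∀ x : K, Valued.v x ≤ 1 → Valued.v (σ x - x) < 1)
    (x₀ : Fin 3 → 𝒪[K]) :
    Valued.v (B₀ σ 3 (fun i => (x₀ i : K)) (fun i => (x₀ i : K))) < 1 ↔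
      (fun i => IsLocalRing.residue 𝒪[K] (x₀ i)) ⬝ᵥ (((StdForm.antidiagonal 3).over 𝓀[K]) *ᵥ (fun i => IsLocalRing.residue 𝒪[K] (x₀ i))) = 0 := by
  have hcoe : B₀ σ 3 (fun i => (x₀ i : K)) (fun i => (x₀ i : K)) =
      ((∑ i, (⟨σ (x₀ i : K), map_coe_mem_integer hvσ (x₀ i)⟩ : 𝒪[K]) * x₀ (Fin.rev i) : 𝒪[K]) : K) := by
    rw [B₀_apply]; push_cast; rfl
  rw [hcoe, ← residue_eq_zero_iff_v_lt_one, map_sum, dotProduct_antidiagonal_three_mulVec_eq_sum]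
  simp only [map_mul, residue_map_sigma_eq hvσ hres]

/-- **RESIDUAL READING OF THE TEST**: for `x ∈ 𝒪³` and `γ′ ≡ 1 (mod ϖ)` with `Y₀ = ϖ⁻¹(γ′ − 1)` entrywise in `𝒪`:
`|ϖ⁻¹·B₀(x, (γ′ − 1)x)| < 1 ↔ ᵗx̄ (J̄₀ Ȳ) x̄ = 0`, `Ȳ = Y₀ mod ϖ` — the certificate's `v̄ᵀ(ḠȲ)v̄ = 0`. [cite: Tits1979, §3.5] [cite: Kottwitz1986, §3] -/
theorem v_test_lt_one_iff_residue (hvσ : ∀ a, Valued.v (σ a) = Valued.v a) (hres : ∀ x : K, Valued.v x ≤ 1 → Valued.v (σ x - x) < 1)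
    (hϖ : Valued.v ϖ = WithZero.exp (-1 : ℤ)) (M : Matrix (Fin 3) (Fin 3) K) (Y₀ : Matrix (Fin 3) (Fin 3) 𝒪[K])
    (hY₀ : ∀ i j, ((Y₀ i j : 𝒪[K]) : K) = ϖ⁻¹ * M i j) (x₀ : Fin 3 → 𝒪[K]) :
    Valued.v (ϖ⁻¹ * B₀ σ 3 (fun i => (x₀ i : K)) (M *ᵥ (fun i => (x₀ i : K)))) < 1 ↔
      (fun i => IsLocalRing.residue 𝒪[K] (x₀ i)) ⬝ᵥ ((((StdForm.antidiagonal 3).over 𝓀[K]) * Y₀.map (IsLocalRing.residue 𝒪[K])) *ᵥ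
        (fun i => IsLocalRing.residue 𝒪[K] (x₀ i))) = 0 := by
  have hϖ0 : ϖ ≠ 0 := uniformizer_ne_zero hϖ
  -- `M = ϖ • Y₀`, so `ϖ⁻¹ B₀(x, Mx) = B₀(x, Y₀x)`
  have hM : M = ϖ • (Y₀.map (fun y : 𝒪[K] => (y : K))) := by
    ext i j
    rw [Matrix.smul_apply, Matrix.map_apply, hY₀, smul_eq_mul, mul_inv_cancel_left₀ hϖ0]
  have hmv : M *ᵥ (fun i => (x₀ i : K)) = ϖ • ((Y₀.map (fun y : 𝒪[K] => (y : K))) *ᵥ (fun i => (x₀ i : K))) := by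
    rw [hM, Matrix.smul_mulVec]
  rw [hmv, map_smul, smul_eq_mul, inv_mul_cancel_left₀ hϖ0]
  -- `B₀(x, Y₀x)` is the coercion of an element of `𝒪`
  have hmap : (Y₀.map (fun y : 𝒪[K] => (y : K))) *ᵥ (fun i => (x₀ i : K)) = fun j => ((Y₀ *ᵥ x₀) j : K) := by
    ext j
    simp [Matrix.mulVec, dotProduct]
  have hcoe : B₀ σ 3 (fun i => (x₀ i : K)) ((Y₀.map (fun y : 𝒪[K] => (y : K))) *ᵥ (fun i => (x₀ i : K))) =
      ((∑ i, (⟨σ (x₀ i : K), map_coe_mem_integer hvσ (x₀ i)⟩ : 𝒪[K]) * (Y₀ *ᵥ x₀) (Fin.rev i) : 𝒪[K]) : K) := by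
    rw [hmap, B₀_apply]; push_cast; rfl
  rw [hcoe, ← residue_eq_zero_iff_v_lt_one, map_sum, ← Matrix.mulVec_mulVec, dotProduct_antidiagonal_three_mulVec_eq_sum]
  have hres' : (Y₀.map (IsLocalRing.residue 𝒪[K])) *ᵥ (fun i => IsLocalRing.residue 𝒪[K] (x₀ i)) = fun j => IsLocalRing.residue 𝒪[K] ((Y₀ *ᵥ x₀) j) := by
    ext j
    simp [Matrix.mulVec, dotProduct, map_sum]
  rw [hres']
  simp only [map_mul, residue_map_sigma_eq hvσ hres]

/-- **PRIMITIVITY**: for `x ∈ 𝒪³`, `(∃ j, |x_j| = 1) ↔ x̄ ≠ 0`. [cite: Serre1980Trees, II.1.1] -/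
theorem exists_v_eq_one_iff_residue_ne_zero (x₀ : Fin 3 → 𝒪[K]) :
    (∃ j, Valued.v ((x₀ j : 𝒪[K]) : K) = 1) ↔ (fun i => IsLocalRing.residue 𝒪[K] (x₀ i)) ≠ 0 := by
  constructor
  · rintro ⟨j, hj⟩ h0
    have h := congrFun h0 j
    rw [Pi.zero_apply, residue_eq_zero_iff_v_lt_one] at h
    exact (ne_of_lt h) hj
  · intro hne
    by_contra hall
    push Not at hall
    apply hne
    funext j
    rw [Pi.zero_apply, residue_eq_zero_iff_v_lt_one]
    exact lt_of_le_of_ne (x₀ j).2 (hall j)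

/-! ## §2 The test is a function of the neighbour -/

/-- **Congruent representatives give the same test**: if `x′ ≡ c·x (mod 𝔪)` with `|c| = 1` (`x, x′ ∈ 𝒪³`) and `M ≡ 0 (mod ϖ)` entrywise, then
`|ϖ⁻¹B₀(x′, Mx′)| < 1 ↔ |ϖ⁻¹B₀(x, Mx)|  < 1` (residually the form is multiplied by `c̄² ≠ 0`). [cite: Tits1979, §3.5] [cite: Serre1980Trees, II.1.1] -/
theorem v_test_lt_one_iff_of_exists_unit_congr (hvσ : ∀ a, Valued.v (σ a) = Valued.v a) (hres : ∀ x : K, Valued.v x ≤ 1 → Valued.v (σ x - x) < 1)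
    (hϖ : Valued.v ϖ = WithZero.exp (-1 : ℤ)) {M : Matrix (Fin 3) (Fin 3) K} (hM : ∀ i j, Valued.v (M i j) ≤ Valued.v ϖ)
    {x x' : Fin 3 → K} (hx : x ∈ stdLattice K 3) (hx' : x' ∈ stdLattice K 3)
    (h : ∃ c : K, Valued.v c = 1 ∧ ∀ i, Valued.v (x' i - c * x i) < 1) :
    Valued.v (ϖ⁻¹ * B₀ σ 3 x' (M *ᵥ x')) < 1 ↔ Valued.v (ϖ⁻¹ * B₀ σ 3 x (M *ᵥ x)) < 1 := by
  have hϖ0 : ϖ ≠ 0 := uniformizer_ne_zero hϖ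
  have hvϖ0 : Valued.v ϖ ≠ 0 := (Valuation.ne_zero_iff _).2 hϖ0
  obtain ⟨c, hc, hcong⟩ := h
  -- integral models
  set x₀ : Fin 3 → 𝒪[K] := fun i => ⟨x i, (Valuation.mem_integer_iff _ _).2 (hx i)⟩ with hx₀
  set x₀' : Fin 3 → 𝒪[K] := fun i => ⟨x' i, (Valuation.mem_integer_iff _ _).2 (hx' i)⟩ with hx₀'
  have hY : ∀ i j, ϖ⁻¹ * M i j ∈ 𝒪[K] := fun i j => by
    refine (Valuation.mem_integer_iff _ _).2 ?_
    rw [map_mul, map_inv₀]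
    calc (Valued.v ϖ)⁻¹ * Valued.v (M i j) ≤ (Valued.v ϖ)⁻¹ * Valued.v ϖ := mul_le_mul' le_rfl (hM i j)
      _ = 1 := inv_mul_cancel₀ hvϖ0
  set Y₀ : Matrix (Fin 3) (Fin 3) 𝒪[K] := fun i j => ⟨ϖ⁻¹ * M i j, hY i j⟩ with hY₀
  have hY₀' : ∀ i j, ((Y₀ i j : 𝒪[K]) : K) = ϖ⁻¹ * M i j := fun _ _ => rfl
  have ex : x = fun i => (x₀ i : K) := funext fun _ => rfl
  have ex' : x' = fun i => (x₀' i : K) := funext fun _ => rfl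
  have cO : c ∈ 𝒪[K] := (Valuation.mem_integer_iff _ _).2 hc.le
  -- residually `x̄′ = c̄ • x̄`
  have hbar : (fun i => IsLocalRing.residue 𝒪[K] (x₀' i)) = IsLocalRing.residue 𝒪[K] ⟨c, cO⟩ • (fun i => IsLocalRing.residue 𝒪[K] (x₀ i)) := by
    funext i
    rw [Pi.smul_apply, smul_eq_mul, ← map_mul, ← sub_eq_zero, ← map_sub, residue_eq_zero_iff_v_lt_one]
    exact hcong i
  have hc0 : IsLocalRing.residue 𝒪[K] ⟨c, cO⟩ ≠ 0 := by
    rw [Ne, residue_eq_zero_iff_v_lt_one]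
    exact fun hlt => (ne_of_lt hlt) hc
  rw [ex, ex', v_test_lt_one_iff_residue hvσ hres hϖ M Y₀ hY₀' x₀', v_test_lt_one_iff_residue hvσ hres hϖ M Y₀ hY₀' x₀, hbar,
    Matrix.mulVec_smul, dotProduct_smul, smul_dotProduct, smul_eq_mul, smul_eq_mul, ← mul_assoc, mul_eq_zero,
    or_iff_right (mul_ne_zero hc0 hc0)]

omit [Valued K ℤᵐ⁰] in
/-- The first column of `κ` as `κ·e₀`. [cite: BruhatTits1972, §10] -/
theorem col_zero_eq_mulVec_single (κ : Matrix (Fin 3) (Fin 3) K) : (fun i => κ i 0) = κ *ᵥ (Pi.single 0 1) := by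
  ext i
  rw [Matrix.mulVec, dotProduct, Finset.sum_eq_single (0 : Fin 3)]
  · rw [Pi.single_eq_same, mul_one]
  · intro j _ hj; rw [Pi.single_eq_of_ne hj, mul_zero]
  · intro h; exact absurd (Finset.mem_univ _) h

/-- **UNIQUENESS OF THE NORMALISED PARAMETER** (★ R2b's injectivity, extracted): two normalised vectors `x_p`, `x_{p′}` (`x_∞ = e₂`, `x_(ā,b̄) = (1, lift ā, lift b̄)`) with the same
residual hyperplane `{y ∈ 𝒪³ : |B₀(x, y)| < 1}` have `p = p′`. [cite: BruhatTits1972, §10] [cite: Serre1980Trees, II.1.1] -/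
theorem normalForm_eq_of_forall_v_B₀_lt_one_iff (hvσ : ∀ a, Valued.v (σ a) = Valued.v a) (σk : 𝓀[K] →+* 𝓀[K])
    (lift : 𝓀[K] → 𝒪[K]) (hlift : ∀ a, IsLocalRing.residue 𝒪[K] (lift a) = a)
    {p p' : Option {p : 𝓀[K] × 𝓀[K] // p.2 + σk p.2 + p.1 * σk p.1 = 0}}
    (hiff : ∀ y ∈ stdLattice K 3,
      (Valued.v (B₀ σ 3 (p.elim (Pi.single 2 1) fun q => ![(1 : K), (lift q.1.1 : K), (lift q.1.2 : K)]) y) < 1 ↔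
        Valued.v (B₀ σ 3 (p'.elim (Pi.single 2 1) fun q => ![(1 : K), (lift q.1.1 : K), (lift q.1.2 : K)]) y) < 1)) :
    p = p' := by
  rcases p with _ | ⟨⟨a, b⟩, hab⟩ <;> rcases p' with _ | ⟨⟨a', b'⟩, hab'⟩
  · rfl
  · exact absurd hiff (not_forall_v_B₀_single_iff_vec hvσ _ _)
  · exact absurd (fun y hy => (hiff y hy).symm) (not_forall_v_B₀_single_iff_vec hvσ _ _)
  · obtain ⟨ha, hb⟩ := residue_eq_of_forall_v_B₀_vec_iff hvσ hiff
    simp only [hlift] at ha hb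
    subst ha hb
    rfl

/-- **THE TEST TRANSFERS TO THE NORMALISED REPRESENTATIVE**: if `x ∈ 𝒪³` is primitive and exactly isotropic and cuts out the same residual hyperplane as the normalised
vector `x_p`, then the test holds at `x` iff it holds at `x_p` (`x ≡ c·x_{p(x)}` by ★ R2b's normal form, `p(x) = p` by uniqueness). [cite: Tits1979, §3.5] -/
theorem v_test_lt_one_iff_normalForm (hvσ : ∀ a, Valued.v (σ a) = Valued.v a) (hres : ∀ x : K, Valued.v x ≤ 1 → Valued.v (σ x - x) < 1)
    (hϖ : Valued.v ϖ = WithZero.exp (-1 : ℤ)) (σk : 𝓀[K] →+* 𝓀[K])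
    (hσk : ∀ x : 𝒪[K], IsLocalRing.residue 𝒪[K] ⟨σ x, map_coe_mem_integer hvσ x⟩ = σk (IsLocalRing.residue 𝒪[K] x))
    (lift : 𝓀[K] → 𝒪[K]) (hlift : ∀ a, IsLocalRing.residue 𝒪[K] (lift a) = a)
    {M : Matrix (Fin 3) (Fin 3) K} (hM : ∀ i j, Valued.v (M i j) ≤ Valued.v ϖ)
    {x : Fin 3 → K} (hx : x ∈ stdLattice K 3) (hunit : ∃ j, Valued.v (x j) = 1) (hiso : B₀ σ 3 x x = 0)
    (p : Option {p : 𝓀[K] × 𝓀[K] // p.2 + σk p.2 + p.1 * σk p.1 = 0})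
    (hiff : ∀ y ∈ stdLattice K 3,
      (Valued.v (B₀ σ 3 x y) < 1 ↔ Valued.v (B₀ σ 3 (p.elim (Pi.single 2 1) fun q => ![(1 : K), (lift q.1.1 : K), (lift q.1.2 : K)]) y) < 1)) :
    Valued.v (ϖ⁻¹ * B₀ σ 3 x (M *ᵥ x)) < 1 ↔
      Valued.v (ϖ⁻¹ * B₀ σ 3 (p.elim (Pi.single 2 1) fun q => ![(1 : K), (lift q.1.1 : K), (lift q.1.2 : K)])
        (M *ᵥ (p.elim (Pi.single 2 1) fun q => ![(1 : K), (lift q.1.1 : K), (lift q.1.2 : K)]))) < 1 := by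
  have hxpL : ∀ p' : Option {p : 𝓀[K] × 𝓀[K] // p.2 + σk p.2 + p.1 * σk p.1 = 0},
      (p'.elim (Pi.single 2 1) fun q => ![(1 : K), (lift q.1.1 : K), (lift q.1.2 : K)]) ∈ stdLattice K 3 := by
    rintro (_ | q)
    · exact single_mem_stdLattice 2
    · exact vec_mem_stdLattice _ _
  -- the normal form of `x`
  rcases exists_unit_congr_normalForm_of_isotropic_of_v hvσ (map_coe_mem_integer hvσ) σk hσk lift hlift hx hunit hiso with hc | ⟨p'', hc⟩
  · -- `x ≡ c·e₂`: then `p = none`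
    have hiff' : ∀ y ∈ stdLattice K 3, (Valued.v (B₀ σ 3 x y) < 1 ↔ Valued.v (B₀ σ 3 (Pi.single 2 1 : Fin 3 → K) y) < 1) :=
      forall_v_B₀_lt_one_iff_of_exists_unit_congr hvσ hc
    have hp : p = none := by
      refine normalForm_eq_of_forall_v_B₀_lt_one_iff hvσ σk lift hlift (p := p) (p' := none) fun y hy => ?_
      rw [← hiff y hy, hiff' y hy]; rfl
    subst hp
    exact v_test_lt_one_iff_of_exists_unit_congr hvσ hres hϖ hM (single_mem_stdLattice 2) hx hc
  · have hiff' : ∀ y ∈ stdLattice K 3, (Valued.v (B₀ σ 3 x y) < 1 ↔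
        Valued.v (B₀ σ 3 (![(1 : K), (lift p''.1.1 : K), (lift p''.1.2 : K)] : Fin 3 → K) y) < 1) :=
      forall_v_B₀_lt_one_iff_of_exists_unit_congr hvσ hc
    have hp : p = some p'' := by
      refine normalForm_eq_of_forall_v_B₀_lt_one_iff hvσ σk lift hlift (p := p) (p' := some p'') fun y hy => ?_
      rw [← hiff y hy, hiff' y hy]; rfl
    subst hp
    exact v_test_lt_one_iff_of_exists_unit_congr hvσ hres hϖ hM (vec_mem_stdLattice _ _) hx hc

/-- **«`w` PASSES» IS READ ON ANY PRIMITIVE ISOTROPIC VECTOR CUTTING OUT `w`**: for `γ′ ∈ K₀`, `γ′ ≡ 1 (mod ϖ)`, a neighbour `w` of the root and `x ∈ 𝒪³` primitive, exactly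
isotropic with `w = N_x = {y ∈ 𝒪³ : |B₀(x,y)| < 1}`: every vertex adjacent to `w` is fixed by `γ′` iff `|ϖ⁻¹·B₀(x, (γ′ − 1)x)| < 1` (★ G3⁺ for `x = κe₀`, `w = κ·N₁`, and §2's
transfer through the normalised representative). [cite: Tits1979, §3.5] [cite: BruhatTits1972, §10] [cite: Kottwitz1986, §3] -/
theorem forall_fixed_neighbor_iff_v_test_lt_one (hσ : ∀ x, σ (σ x) = x) (hvσ : ∀ a, Valued.v (σ a) = Valued.v a) (hσϖ : σ ϖ = -ϖ)
    (hϖ : Valued.v ϖ = WithZero.exp (-1 : ℤ)) (hres : ∀ x : K, Valued.v x ≤ 1 → Valued.v (σ x - x) < 1) (h2 : Valued.v (2 : K) = 1) [Finite 𝓀[K]]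
    {γ : unitaryGroupOfForm σ ((StdForm.antidiagonal 3).over K)} (hγK : γ ∈ unitaryInt σ ((StdForm.antidiagonal 3).over K))
    (hγϖ : ∀ i j, Valued.v ((((γ : GL (Fin 3) K) : Matrix (Fin 3) (Fin 3) K) - 1) i j) ≤ Valued.v ϖ)
    {w : {M : Submodule 𝒪[K] (Fin 3 → K) // IsVertex σ ϖ ((StdForm.antidiagonal 3).over K) M}}
    (hw : w ∈ (latticeGraph σ ϖ ((StdForm.antidiagonal 3).over K)).neighborSet ⟨stdLattice K 3, 0, isSelfDualLattice_stdLattice_three_of_v hϖ⟩)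
    {x : Fin 3 → K} (hx : x ∈ stdLattice K 3) (hunit : ∃ j, Valued.v (x j) = 1) (hiso : B₀ σ 3 x x = 0)
    (hwx : ∀ y, y ∈ w.1 ↔ y ∈ stdLattice K 3 ∧ Valued.v (B₀ σ 3 x y) < 1) :
    (∀ w' ∈ (latticeGraph σ ϖ ((StdForm.antidiagonal 3).over K)).neighborSet w, latticeGraphIso σ ϖ ((StdForm.antidiagonal 3).over K) γ w' = w') ↔
      Valued.v (ϖ⁻¹ * B₀ σ 3 x ((((γ : GL (Fin 3) K) : Matrix (Fin 3) (Fin 3) K) - 1) *ᵥ x)) < 1 := by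
  classical
  have hϖ0 : ϖ ≠ 0 := uniformizer_ne_zero hϖ
  have hlt1 : ∀ z : K, Valued.v z < 1 ↔ Valued.v z ≤ Valued.v ϖ := fun z => by rw [hϖ]; exact v_lt_one_iff z
  have h20 : (2 : K) ≠ 0 := fun h => by rw [h, map_zero] at h2; exact zero_ne_one h2
  have htrace : ∃ t : K, Valued.v t ≤ 1 ∧ t + σ t = 1 :=
    ⟨2⁻¹, by rw [map_inv₀, h2, inv_one], by rw [map_inv₀, map_ofNat]; field_simp; norm_num⟩
  -- a section of the residue map, and `σk = id`
  obtain ⟨lift, hlift⟩ : ∃ lift : 𝓀[K] → 𝒪[K], ∀ a, IsLocalRing.residue 𝒪[K] (lift a) = a :=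
    ⟨Function.surjInv IsLocalRing.residue_surjective, Function.surjInv_eq IsLocalRing.residue_surjective⟩
  have hσk : ∀ y : 𝒪[K], IsLocalRing.residue 𝒪[K] ⟨σ y, map_coe_mem_integer hvσ y⟩ = (RingHom.id 𝓀[K]) (IsLocalRing.residue 𝒪[K] y) :=
    fun y => by rw [RingHom.id_apply]; exact residue_map_sigma_eq hvσ hres y
  -- `w = κ·N₁`, `κ ∈ K₀`; its first column `x′ = κe₀`
  obtain ⟨κ, hκ, hwκ⟩ := (mem_neighborSet_root_iff_exists_mem_unitaryInt_of_trace hσ hvσ hϖ htrace (isVertexLattice_two_N₁_of_neg hσϖ hϖ) w).1 hw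
  have hwv : w = latticeGraphIso σ ϖ ((StdForm.antidiagonal 3).over K) κ ⟨latt (Matrix.diagonal ![(1 : K), 1, ϖ]), 2, isVertexLattice_two_N₁_of_neg hσϖ hϖ⟩ :=
    Subtype.ext (by rw [latticeGraphIso_apply_val]; exact hwκ)
  obtain ⟨hx'L, hx'iso, hx'unit⟩ := firstColumn_props (K := K) hκ
  have hwx' : ∀ y, y ∈ w.1 ↔ y ∈ stdLattice K 3 ∧ Valued.v (B₀ σ 3 (((κ : GL (Fin 3) K) : Matrix (Fin 3) (Fin 3) K) *ᵥ (Pi.single 0 1)) y) < 1 := by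
    intro y
    rw [hwκ]
    constructor
    · intro hy
      have hyL : y ∈ stdLattice K 3 := (mapGL_N₁_le hκ (uniformizer_mem_integer hϖ) hϖ0).2 hy
      exact ⟨hyL, (hlt1 _).2 ((mem_mapGL_N₁_iff hκ hϖ0 hyL).1 hy)⟩
    · rintro ⟨hyL, hB⟩
      exact (mem_mapGL_N₁_iff hκ hϖ0 hyL).2 ((hlt1 _).1 hB)
  -- ★ G3⁺ at `u = 1`: passing ⟺ the test at `x′`
  have hγK1 : (1 : unitaryGroupOfForm σ ((StdForm.antidiagonal 3).over K))⁻¹ * γ * 1 ∈ unitaryInt σ ((StdForm.antidiagonal 3).over K) := by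
    rw [inv_one, one_mul, mul_one]; exact hγK
  have hγϖ1 : ∀ i j, Valued.v ((((((1 : unitaryGroupOfForm σ ((StdForm.antidiagonal 3).over K))⁻¹ * γ * 1 :
      unitaryGroupOfForm σ ((StdForm.antidiagonal 3).over K)) : GL (Fin 3) K) : Matrix (Fin 3) (Fin 3) K) - 1) i j) ≤ Valued.v ϖ := by
    rw [inv_one, one_mul, mul_one]; exact hγϖ
  have key := forall_fixed_neighbor_iff_v_B₀_lt_one_of_congr hvσ hσϖ hϖ hres hγK1 hκ hγϖ1
  rw [inv_one, one_mul, mul_one, one_mul, ← hwv, col_zero_eq_mulVec_single] at key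
  rw [key]
  -- transfer `x′ ↝ x_p ↜ x` through the common normalised representative `p` of the hyperplane
  have hM : ∀ i j, Valued.v ((((γ : GL (Fin 3) K) : Matrix (Fin 3) (Fin 3) K) - 1) i j) ≤ Valued.v ϖ := hγϖ
  -- normal form `p` of `x`
  have hiffxx' : ∀ y ∈ stdLattice K 3, (Valued.v (B₀ σ 3 x y) < 1 ↔
      Valued.v (B₀ σ 3 (((κ : GL (Fin 3) K) : Matrix (Fin 3) (Fin 3) K) *ᵥ (Pi.single 0 1)) y) < 1) := fun y hy => by
    rw [← (hwx y).trans (and_iff_right hy), (hwx' y).trans (and_iff_right hy)]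
  rcases exists_unit_congr_normalForm_of_isotropic_of_v hvσ (map_coe_mem_integer hvσ) (RingHom.id 𝓀[K]) hσk lift hlift hx hunit hiso with hc | ⟨p, hc⟩
  · have hiffp : ∀ y ∈ stdLattice K 3, (Valued.v (B₀ σ 3 x y) < 1 ↔ Valued.v (B₀ σ 3 (Pi.single 2 1 : Fin 3 → K) y) < 1) :=
      forall_v_B₀_lt_one_iff_of_exists_unit_congr hvσ hc
    have h1 := v_test_lt_one_iff_normalForm hvσ hres hϖ (RingHom.id 𝓀[K]) hσk lift hlift hM hx'L hx'unit hx'iso none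
      (fun y hy => by rw [← hiffxx' y hy, hiffp y hy]; rfl)
    have h2' := v_test_lt_one_iff_of_exists_unit_congr hvσ hres hϖ hM (single_mem_stdLattice 2) hx hc
    rw [h1]; exact h2'.symm
  · have hiffp : ∀ y ∈ stdLattice K 3, (Valued.v (B₀ σ 3 x y) < 1 ↔
        Valued.v (B₀ σ 3 (![(1 : K), (lift p.1.1 : K), (lift p.1.2 : K)] : Fin 3 → K) y) < 1) :=
      forall_v_B₀_lt_one_iff_of_exists_unit_congr hvσ hc
    have h1 := v_test_lt_one_iff_normalForm hvσ hres hϖ (RingHom.id 𝓀[K]) hσk lift hlift hM hx'L hx'unit hx'iso (some p)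
      (fun y hy => by rw [← hiffxx' y hy, hiffp y hy]; rfl)
    have h2' := v_test_lt_one_iff_of_exists_unit_congr hvσ hres hϖ hM (vec_mem_stdLattice _ _) hx hc
    rw [h1]; exact h2'.symm

/-! ## §3 `ν` = the number of `Q_Ȳ`-null normalised isotropic parameters -/

/-- **THE ν-BRIDGE AT THE ROOT**: for `γ ∈ K₀` with `γ ≡ 1 (mod ϖ)` and `Y₀ = ϖ⁻¹(γ − 1)` (entrywise in `𝒪`), the number of neighbours `w` of the root `L₀` such that `γ` fixes
every vertex adjacent to `w` equals the number of NORMALISED ISOTROPIC PARAMETERS `p ∈ {∞} ⊔ {(ā,b̄) : 2b̄ + ā² = 0}` (★ R2b: `x̄_∞ = e₂`, `x̄_(ā,b̄) = (1,ā,b̄)`, one per point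
of the residual conic) with **`ᵗx̄_p (J̄₀ Ȳ) x̄_p = 0`**, `Ȳ = Y₀ mod ϖ` (★ R2b's bijection `p ↦ N_{x_p}` restricted by §2). [cite: BruhatTits1972, §10] [cite: Tits1979, §2.4, §3.5]
[cite: Serre1980Trees, II.1.1] [cite: Kottwitz1986, §3] -/
theorem ncard_passingNeighbors_root_eq_natCard (hσ : ∀ x, σ (σ x) = x) (hvσ : ∀ a, Valued.v (σ a) = Valued.v a) (hσϖ : σ ϖ = -ϖ)
    (hϖ : Valued.v ϖ = WithZero.exp (-1 : ℤ)) (hres : ∀ x : K, Valued.v x ≤ 1 → Valued.v (σ x - x) < 1) (h2 : Valued.v (2 : K) = 1) [Finite 𝓀[K]]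
    {γ : unitaryGroupOfForm σ ((StdForm.antidiagonal 3).over K)} (hγK : γ ∈ unitaryInt σ ((StdForm.antidiagonal 3).over K))
    (hγϖ : ∀ i j, Valued.v ((((γ : GL (Fin 3) K) : Matrix (Fin 3) (Fin 3) K) - 1) i j) ≤ Valued.v ϖ)
    (Y₀ : Matrix (Fin 3) (Fin 3) 𝒪[K]) (hY₀ : ∀ i j, ((Y₀ i j : 𝒪[K]) : K) = ϖ⁻¹ * ((((γ : GL (Fin 3) K) : Matrix (Fin 3) (Fin 3) K) - 1) i j)) :
    {w | w ∈ (latticeGraph σ ϖ ((StdForm.antidiagonal 3).over K)).neighborSet ⟨stdLattice K 3, 0, isSelfDualLattice_stdLattice_three_of_v hϖ⟩ ∧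
        ∀ w' ∈ (latticeGraph σ ϖ ((StdForm.antidiagonal 3).over K)).neighborSet w, latticeGraphIso σ ϖ ((StdForm.antidiagonal 3).over K) γ w' = w'}.ncard =
      Nat.card {p : Option {p : 𝓀[K] × 𝓀[K] // p.2 + (RingHom.id 𝓀[K]) p.2 + p.1 * (RingHom.id 𝓀[K]) p.1 = 0} //
        (p.elim (Pi.single 2 1) fun q => ![(1 : 𝓀[K]), q.1.1, q.1.2]) ⬝ᵥ
          ((((StdForm.antidiagonal 3).over 𝓀[K]) * Y₀.map (IsLocalRing.residue 𝒪[K])) *ᵥ (p.elim (Pi.single 2 1) fun q => ![(1 : 𝓀[K]), q.1.1, q.1.2])) = 0} := by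
  classical
  have hϖ0 : ϖ ≠ 0 := uniformizer_ne_zero hϖ
  have hlt1 : ∀ z : K, Valued.v z < 1 ↔ Valued.v z ≤ Valued.v ϖ := fun z => by rw [hϖ]; exact v_lt_one_iff z
  have h20 : (2 : K) ≠ 0 := fun h => by rw [h, map_zero] at h2; exact zero_ne_one h2
  have htrace : ∃ t : K, Valued.v t ≤ 1 ∧ t + σ t = 1 :=
    ⟨2⁻¹, by rw [map_inv₀, h2, inv_one], by rw [map_inv₀, map_ofNat]; field_simp; norm_num⟩
  have hN₁ := isVertexLattice_two_N₁_of_neg (σ := σ) hσϖ hϖ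
  obtain ⟨lift, hlift⟩ : ∃ lift : 𝓀[K] → 𝒪[K], ∀ a, IsLocalRing.residue 𝒪[K] (lift a) = a :=
    ⟨Function.surjInv IsLocalRing.residue_surjective, Function.surjInv_eq IsLocalRing.residue_surjective⟩
  have hσO : ∀ x : 𝒪[K], σ x ∈ 𝒪[K] := map_coe_mem_integer hvσ
  have hσk : ∀ y : 𝒪[K], IsLocalRing.residue 𝒪[K] ⟨σ y, hσO y⟩ = (RingHom.id 𝓀[K]) (IsLocalRing.residue 𝒪[K] y) :=
    fun y => by rw [RingHom.id_apply]; exact residue_map_sigma_eq hvσ hres y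
  have hM : ∀ i j, Valued.v ((((γ : GL (Fin 3) K) : Matrix (Fin 3) (Fin 3) K) - 1) i j) ≤ Valued.v ϖ := hγϖ
  -- the normalised vectors over `K` and over `𝒪`
  let xOf : Option {p : 𝓀[K] × 𝓀[K] // p.2 + (RingHom.id 𝓀[K]) p.2 + p.1 * (RingHom.id 𝓀[K]) p.1 = 0} → (Fin 3 → K) := fun p =>
    p.elim (Pi.single 2 1) fun q => ![(1 : K), (lift q.1.1 : K), (lift q.1.2 : K)]
  have hxOf : ∀ p, xOf p = p.elim (Pi.single 2 1) fun q => ![(1 : K), (lift q.1.1 : K), (lift q.1.2 : K)] := fun _ => rfl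
  have hxOf_none : xOf none = Pi.single 2 1 := rfl
  have hxOf_some : ∀ q, xOf (some q) = ![(1 : K), (lift q.1.1 : K), (lift q.1.2 : K)] := fun _ => rfl
  let xO : Option {p : 𝓀[K] × 𝓀[K] // p.2 + (RingHom.id 𝓀[K]) p.2 + p.1 * (RingHom.id 𝓀[K]) p.1 = 0} → (Fin 3 → 𝒪[K]) := fun p =>
    p.elim (Pi.single 2 1) fun q => ![(1 : 𝒪[K]), lift q.1.1, lift q.1.2]
  have hxO : ∀ p, (fun i => ((xO p i : 𝒪[K]) : K)) = xOf p := by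
    rintro (_ | q)
    · funext i; change ((((Pi.single 2 1 : Fin 3 → 𝒪[K]) i) : 𝒪[K]) : K) = (Pi.single 2 1 : Fin 3 → K) i
      fin_cases i <;> simp
    · funext i; change (((![(1 : 𝒪[K]), lift q.1.1, lift q.1.2] : Fin 3 → 𝒪[K]) i : 𝒪[K]) : K) = (![(1 : K), (lift q.1.1 : K), (lift q.1.2 : K)] : Fin 3 → K) i
      fin_cases i <;> simp
  have hxObar : ∀ p, (fun i => IsLocalRing.residue 𝒪[K] (xO p i)) = p.elim (Pi.single 2 1) fun q => ![(1 : 𝓀[K]), q.1.1, q.1.2] := by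
    rintro (_ | q)
    · funext i; change IsLocalRing.residue 𝒪[K] ((Pi.single 2 1 : Fin 3 → 𝒪[K]) i) = (Pi.single 2 1 : Fin 3 → 𝓀[K]) i
      fin_cases i <;> simp
    · funext i; change IsLocalRing.residue 𝒪[K] ((![(1 : 𝒪[K]), lift q.1.1, lift q.1.2] : Fin 3 → 𝒪[K]) i) = (![(1 : 𝓀[K]), q.1.1, q.1.2] : Fin 3 → 𝓀[K]) i
      fin_cases i <;> simp [hlift]
  have hxL : ∀ p, xOf p ∈ stdLattice K 3 := by
    rintro (_ | q)
    · rw [hxOf_none]; exact single_mem_stdLattice 2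
    · rw [hxOf_some]; exact vec_mem_stdLattice _ _
  have hxu : ∀ p, ∃ j, Valued.v (xOf p j) = 1 := by
    rintro (_ | q)
    · exact ⟨2, by rw [hxOf_none]; simp⟩
    · exact ⟨0, by rw [hxOf_some]; simp⟩
  have hxiso : ∀ p, Valued.v (B₀ σ 3 (xOf p) (xOf p)) < 1 := by
    rintro (_ | q)
    · rw [hxOf_none, B₀_single_left, show Fin.rev (2 : Fin 3) = 0 from rfl]; simp
    · rw [hxOf_some]
      refine v_B₀_vec_self_lt_one hσO (RingHom.id 𝓀[K]) hσk ?_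
      rw [hlift, hlift]; exact q.2
  -- the vertices `N_{x_p}` (★ R2b)
  choose f hf using fun p => exists_mem_neighborSet_root_forall_mem_iff_of_trace hσ hvσ hϖ htrace hN₁ (hxL p) (hxu p) (hxiso p)
  have hfiff : ∀ p, ∀ y ∈ stdLattice K 3, (y ∈ (f p).1 ↔ Valued.v (B₀ σ 3 (xOf p) y) < 1) := fun p y hy => by
    rw [(hf p).2 y]; exact ⟨fun h => h.2, fun h => ⟨hy, h⟩⟩
  -- injectivity of `p ↦ f p`
  have hinj : ∀ p p', f p = f p' → p = p' := by
    intro p p' hEq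
    refine normalForm_eq_of_forall_v_B₀_lt_one_iff hvσ (RingHom.id 𝓀[K]) lift hlift fun y hy => ?_
    rw [← hxOf, ← hxOf, ← hfiff p y hy, ← hfiff p' y hy, hEq]
  -- surjectivity of `p ↦ f p`
  have hsurj : ∀ w ∈ (latticeGraph σ ϖ ((StdForm.antidiagonal 3).over K)).neighborSet ⟨stdLattice K 3, 0, isSelfDualLattice_stdLattice_three_of_v hϖ⟩, ∃ p, f p = w := by
    intro w hw
    obtain ⟨x, hx, hunit, hiso, hmem⟩ := exists_isotropic_forall_mem_iff_of_mem_neighborSet_root_of_trace hσ hvσ hϖ htrace hN₁ hw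
    have key : ∀ p, (∃ c : K, Valued.v c = 1 ∧ ∀ i, Valued.v (x i - c * xOf p i) < 1) → f p = w := fun p hc => by
      refine eq_of_forall_mem_iff fun y => ?_
      rw [(hf p).2 y, hmem y]
      exact and_congr_right fun hy => (forall_v_B₀_lt_one_iff_of_exists_unit_congr hvσ hc y hy).symm
    rcases exists_unit_congr_normalForm_of_isotropic_of_v hvσ hσO (RingHom.id 𝓀[K]) hσk lift hlift hx hunit hiso with hc | ⟨p, hc⟩
    · exact ⟨none, key none (by rw [hxOf_none]; exact hc)⟩
    · exact ⟨some p, key (some p) (by rw [hxOf_some]; exact hc)⟩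
  -- KEY: `f p` passes iff `x̄_p` is `Q_Ȳ`-null
  have hkey : ∀ p, (∀ w' ∈ (latticeGraph σ ϖ ((StdForm.antidiagonal 3).over K)).neighborSet (f p), latticeGraphIso σ ϖ ((StdForm.antidiagonal 3).over K) γ w' = w') ↔
      (p.elim (Pi.single 2 1) fun q => ![(1 : 𝓀[K]), q.1.1, q.1.2]) ⬝ᵥ
        ((((StdForm.antidiagonal 3).over 𝓀[K]) * Y₀.map (IsLocalRing.residue 𝒪[K])) *ᵥ (p.elim (Pi.single 2 1) fun q => ![(1 : 𝓀[K]), q.1.1, q.1.2])) = 0 := by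
    intro p
    -- `f p = κ·N₁`, `x′ = κe₀` exactly isotropic with the same hyperplane
    obtain ⟨κ, hκ, hwκ⟩ := (mem_neighborSet_root_iff_exists_mem_unitaryInt_of_trace hσ hvσ hϖ htrace hN₁ (f p)).1 (hf p).1
    obtain ⟨hx'L, hx'iso, hx'unit⟩ := firstColumn_props (K := K) hκ
    have hwx' : ∀ y, y ∈ (f p).1 ↔ y ∈ stdLattice K 3 ∧ Valued.v (B₀ σ 3 (((κ : GL (Fin 3) K) : Matrix (Fin 3) (Fin 3) K) *ᵥ (Pi.single 0 1)) y) < 1 := by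
      intro y
      rw [hwκ]
      constructor
      · intro hy
        have hyL : y ∈ stdLattice K 3 := (mapGL_N₁_le hκ (uniformizer_mem_integer hϖ) hϖ0).2 hy
        exact ⟨hyL, (hlt1 _).2 ((mem_mapGL_N₁_iff hκ hϖ0 hyL).1 hy)⟩
      · rintro ⟨hyL, hB⟩
        exact (mem_mapGL_N₁_iff hκ hϖ0 hyL).2 ((hlt1 _).1 hB)
    rw [forall_fixed_neighbor_iff_v_test_lt_one hσ hvσ hσϖ hϖ hres h2 hγK hγϖ (hf p).1 hx'L hx'unit hx'iso hwx']
    -- the test at `x′` ↔ the test at `x_p` ↔ the residual condition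
    have hiff : ∀ y ∈ stdLattice K 3, (Valued.v (B₀ σ 3 (((κ : GL (Fin 3) K) : Matrix (Fin 3) (Fin 3) K) *ᵥ (Pi.single 0 1)) y) < 1 ↔
        Valued.v (B₀ σ 3 (p.elim (Pi.single 2 1) fun q => ![(1 : K), (lift q.1.1 : K), (lift q.1.2 : K)]) y) < 1) := fun y hy => by
      rw [← (hwx' y).trans (and_iff_right hy), ← hxOf, ← hfiff p y hy]
    rw [v_test_lt_one_iff_normalForm hvσ hres hϖ (RingHom.id 𝓀[K]) hσk lift hlift hM hx'L hx'unit hx'iso p hiff, ← hxOf, ← hxO p,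
      v_test_lt_one_iff_residue hvσ hres hϖ _ Y₀ hY₀ (xO p), hxObar p]
  -- the restricted bijection
  rw [← Nat.card_coe_set_eq]
  refine (Nat.card_congr (Equiv.ofBijective
    (fun p : {p : Option {p : 𝓀[K] × 𝓀[K] // p.2 + (RingHom.id 𝓀[K]) p.2 + p.1 * (RingHom.id 𝓀[K]) p.1 = 0} //
        (p.elim (Pi.single 2 1) fun q => ![(1 : 𝓀[K]), q.1.1, q.1.2]) ⬝ᵥ
          ((((StdForm.antidiagonal 3).over 𝓀[K]) * Y₀.map (IsLocalRing.residue 𝒪[K])) *ᵥ (p.elim (Pi.single 2 1) fun q => ![(1 : 𝓀[K]), q.1.1, q.1.2])) = 0} =>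
      (⟨f p.1, (hf p.1).1, (hkey p.1).2 p.2⟩ :
        {w | w ∈ (latticeGraph σ ϖ ((StdForm.antidiagonal 3).over K)).neighborSet ⟨stdLattice K 3, 0, isSelfDualLattice_stdLattice_three_of_v hϖ⟩ ∧
          ∀ w' ∈ (latticeGraph σ ϖ ((StdForm.antidiagonal 3).over K)).neighborSet w, latticeGraphIso σ ϖ ((StdForm.antidiagonal 3).over K) γ w' = w'}))
    ⟨?_, ?_⟩)).symm
  · intro p p' hpp'
    exact Subtype.ext (hinj _ _ (congrArg Subtype.val hpp'))
  · rintro ⟨w, hw, hpass⟩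
    obtain ⟨p, hp⟩ := hsurj w hw
    refine ⟨⟨p, (hkey p).1 (by rw [hp]; exact hpass)⟩, Subtype.ext hp⟩

/-- **THE ν-BRIDGE AT A GENERAL SELF-DUAL VERTEX `v = u·L₀`**: with `γ′ = u⁻¹γu ∈ K₀`, `γ′ ≡ 1 (mod ϖ)`, `Y₀ = ϖ⁻¹(γ′ − 1)`: the number of neighbours `c` of `v` all of whose
neighbours are fixed by `γ` equals the number of `Q_Ȳ`-null normalised isotropic parameters (transport of §3's root statement along `u`, ★ G3 §1).
[cite: BruhatTits1972, §10] [cite: Tits1979, §3.5] [cite: Kottwitz1986, §3] -/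
theorem ncard_passingNeighbors_eq_natCard (hσ : ∀ x, σ (σ x) = x) (hvσ : ∀ a, Valued.v (σ a) = Valued.v a) (hσϖ : σ ϖ = -ϖ)
    (hϖ : Valued.v ϖ = WithZero.exp (-1 : ℤ)) (hres : ∀ x : K, Valued.v x ≤ 1 → Valued.v (σ x - x) < 1) (h2 : Valued.v (2 : K) = 1) [Finite 𝓀[K]]
    {γ u : unitaryGroupOfForm σ ((StdForm.antidiagonal 3).over K)} (hγK : u⁻¹ * γ * u ∈ unitaryInt σ ((StdForm.antidiagonal 3).over K))
    (hγϖ : ∀ i j, Valued.v (((((u⁻¹ * γ * u : unitaryGroupOfForm σ ((StdForm.antidiagonal 3).over K)) : GL (Fin 3) K) : Matrix (Fin 3) (Fin 3) K) - 1) i j) ≤ Valued.v ϖ)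
    (Y₀ : Matrix (Fin 3) (Fin 3) 𝒪[K])
    (hY₀ : ∀ i j, ((Y₀ i j : 𝒪[K]) : K) = ϖ⁻¹ * (((((u⁻¹ * γ * u : unitaryGroupOfForm σ ((StdForm.antidiagonal 3).over K)) : GL (Fin 3) K) : Matrix (Fin 3) (Fin 3) K) - 1) i j)) :
    {c | c ∈ (latticeGraph σ ϖ ((StdForm.antidiagonal 3).over K)).neighborSet
          (latticeGraphIso σ ϖ ((StdForm.antidiagonal 3).over K) u ⟨stdLattice K 3, 0, isSelfDualLattice_stdLattice_three_of_v hϖ⟩) ∧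
        ∀ w ∈ (latticeGraph σ ϖ ((StdForm.antidiagonal 3).over K)).neighborSet c, latticeGraphIso σ ϖ ((StdForm.antidiagonal 3).over K) γ w = w}.ncard =
      Nat.card {p : Option {p : 𝓀[K] × 𝓀[K] // p.2 + (RingHom.id 𝓀[K]) p.2 + p.1 * (RingHom.id 𝓀[K]) p.1 = 0} //
        (p.elim (Pi.single 2 1) fun q => ![(1 : 𝓀[K]), q.1.1, q.1.2]) ⬝ᵥ
          ((((StdForm.antidiagonal 3).over 𝓀[K]) * Y₀.map (IsLocalRing.residue 𝒪[K])) *ᵥ (p.elim (Pi.single 2 1) fun q => ![(1 : 𝓀[K]), q.1.1, q.1.2])) = 0} := by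
  rw [← ncard_passingNeighbors_root_eq_natCard hσ hvσ hσϖ hϖ hres h2 hγK hγϖ Y₀ hY₀]
  -- the passing neighbours of `u·L₀` under `γ` are the `u`-translates of the passing neighbours of `L₀` under `u⁻¹γu`
  have hfixiff : ∀ w : {M : Submodule 𝒪[K] (Fin 3 → K) // IsVertex σ ϖ ((StdForm.antidiagonal 3).over K) M},
      latticeGraphIso σ ϖ ((StdForm.antidiagonal 3).over K) γ (latticeGraphIso σ ϖ ((StdForm.antidiagonal 3).over K) u w) =
          latticeGraphIso σ ϖ ((StdForm.antidiagonal 3).over K) u w ↔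
        latticeGraphIso σ ϖ ((StdForm.antidiagonal 3).over K) (u⁻¹ * γ * u) w = w := by
    intro w
    rw [latticeGraphIso_eq_iff_mapGL_eq, mapGL_latticeGraphIso_eq_iff, latticeGraphIso_eq_iff_mapGL_eq]
  have himage : {c | c ∈ (latticeGraph σ ϖ ((StdForm.antidiagonal 3).over K)).neighborSet
          (latticeGraphIso σ ϖ ((StdForm.antidiagonal 3).over K) u ⟨stdLattice K 3, 0, isSelfDualLattice_stdLattice_three_of_v hϖ⟩) ∧
        ∀ w ∈ (latticeGraph σ ϖ ((StdForm.antidiagonal 3).over K)).neighborSet c, latticeGraphIso σ ϖ ((StdForm.antidiagonal 3).over K) γ w = w} =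
      latticeGraphIso σ ϖ ((StdForm.antidiagonal 3).over K) u ''
        {w | w ∈ (latticeGraph σ ϖ ((StdForm.antidiagonal 3).over K)).neighborSet ⟨stdLattice K 3, 0, isSelfDualLattice_stdLattice_three_of_v hϖ⟩ ∧
          ∀ w' ∈ (latticeGraph σ ϖ ((StdForm.antidiagonal 3).over K)).neighborSet w,
            latticeGraphIso σ ϖ ((StdForm.antidiagonal 3).over K) (u⁻¹ * γ * u) w' = w'} := by
    ext c
    simp only [Set.mem_setOf_eq, Set.mem_image, SimpleGraph.mem_neighborSet]
    constructor
    · rintro ⟨hadj, hpass⟩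
      have hc : latticeGraphIso σ ϖ ((StdForm.antidiagonal 3).over K) u (latticeGraphIso σ ϖ ((StdForm.antidiagonal 3).over K) u⁻¹ c) = c :=
        latticeGraphIso_mul_inv_apply u c
      refine ⟨latticeGraphIso σ ϖ ((StdForm.antidiagonal 3).over K) u⁻¹ c, ⟨?_, fun w' hw' => ?_⟩, hc⟩
      · rw [← hc] at hadj
        exact (latticeGraphIso σ ϖ ((StdForm.antidiagonal 3).over K) u).map_adj_iff.1 hadj
      · have hw'' : (latticeGraph σ ϖ ((StdForm.antidiagonal 3).over K)).Adj c (latticeGraphIso σ ϖ ((StdForm.antidiagonal 3).over K) u w') := by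
          rw [← hc]; exact (latticeGraphIso σ ϖ ((StdForm.antidiagonal 3).over K) u).map_adj_iff.2 hw'
        exact (hfixiff w').1 (hpass _ hw'')
    · rintro ⟨w, ⟨hadj, hpass⟩, rfl⟩
      refine ⟨(latticeGraphIso σ ϖ ((StdForm.antidiagonal 3).over K) u).map_adj_iff.2 hadj, fun w' hw' => ?_⟩
      have hw'u : latticeGraphIso σ ϖ ((StdForm.antidiagonal 3).over K) u (latticeGraphIso σ ϖ ((StdForm.antidiagonal 3).over K) u⁻¹ w') = w' :=
        latticeGraphIso_mul_inv_apply u w'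
      rw [← hw'u] at hw' ⊢
      exact (hfixiff _).2 (hpass _ ((latticeGraphIso σ ϖ ((StdForm.antidiagonal 3).over K) u).map_adj_iff.1 hw'))
  rw [himage, Set.ncard_image_of_injective _ (latticeGraphIso σ ϖ ((StdForm.antidiagonal 3).over K) u).injective]

end Literature.NumberTheory.Automorphic.UnitaryLatticeTree

end
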